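import Literature.NumberTheory.Transcendental.FormsAlgebra

/-!
# The wedge product is Mathlib's `AlternatingMap.domCoprod` (named fact discharged)

Topic: algebra of differential forms (`Literature/NumberTheory/Transcendental/FormsAlgebra.lean`).
This theorems-only companion file discharges the named fact

| named fact of `FormsAlgebra.lean`                        | discharged by                                          |
|----------------------------------------------------------|--------------------------------------------------------|
| `ContinuousAlternatingMap.ToAlternatingMapWedge 𝕜 V A`   | `ContinuousAlternatingMap.ToAlternatingMapWedge_holds` |

i.e. for continuous alternating maps `α` of degree `k` and `β` of degree `l` on a normed space `V`
over `𝕜 = ℝ, ℂ` with values in a normed commutative `𝕜`-algebra `A`, the alternating map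
underlying the tree's concrete `α ∧ β` (`ContinuousAlternatingMap.wedge`, full-permutation
normalisation `(α ∧ β)(v) = (k! l!)⁻¹ ∑_{σ ∈ 𝔖_{k+l}} sign σ · α(v ∘ σ|₁) β(v ∘ σ|₂)`,
`ContinuousAlternatingMap.wedge_apply`) is Mathlib's algebraic shuffle product
`AlternatingMap.domCoprod` of the underlying alternating maps (valued in `A ⊗[𝕜] A`,
`Mathlib/LinearAlgebra/Alternating/DomCoprod.lean`), followed by multiplication
`LinearMap.mul' 𝕜 A : A ⊗ A → A` and reindexed along `finSumFinEquiv : Fin k ⊕ Fin l ≃ Fin (k + l)`.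

Source. F. W. Warner, *Foundations of Differentiable Manifolds and Lie Groups*, GTM 94 (1983),
2.10(b): for `f ∈ A_p(V)`, `g ∈ A_q(V)` the product `∧_α` transported from `Λ(V*)` is the shuffle
sum (2) `f ∧_α g (v₁,…,v_{p+q}) = ∑_{p,q shuffles π} sgn π · f(v_{π(1)},…,v_{π(p)})
g(v_{π(p+1)},…,v_{π(p+q)})`, while (3) `f ∧_β g = ((p+q)!)⁻¹ ∑_{π ∈ S_{p+q}} sgn π · f(…) g(…)`,
and "it follows from (2) and (3) that (4) `f ∧_α g = (p+q)!/(p! q!) · f ∧_β g`", i.e. the shuffle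
sum equals `(p! q!)⁻¹` times the full-permutation sum (each of the `(p+q)!/(p! q!)` cosets of
`S_p × S_q` in `S_{p+q}` contributes `p! q!` equal terms, `f`, `g` being alternating). Mathlib's
`domCoprod` is the coset sum (sum over `Equiv.Perm.ModSumCongr`, one representative per coset —
for alternating `a`, `b` the summand does not depend on the representative), and Mathlib proves
(4) in the form `MultilinearMap.domCoprod_alternization_eq`:
`alternatization (domCoprod a b) = (|ιa|! |ιb|!) • a.domCoprod b`. The vendored statement is this
identity for `A`-valued forms (`A` commutative, the two factors multiplied in `A`); it is not
mis-stated.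

## Proof

`mul'_domCoprod_apply`: evaluate `MultilinearMap.domCoprod_alternization_eq` at a point, divide
by `k! l! ≠ 0` in `𝕜` (characteristic zero) and push `mul'` through the signed sum — this is
(4) read backwards: `mul' (a.domCoprod b w) = (k! l!)⁻¹ ∑_{σ ∈ Perm (Fin k ⊕ Fin l)} sign σ ·
a(w ∘ σ ∘ inl) b(w ∘ σ ∘ inr)`. `ToAlternatingMapWedge_holds`: compare with `wedge_apply` after
reindexing the permutations along `finSumFinEquiv.permCongr : Perm (Fin k ⊕ Fin l) ≃ Perm (Fin (k+l))`
(`sign` is invariant, `Equiv.Perm.sign_permCongr`).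

## References

* F. W. Warner, *Foundations of Differentiable Manifolds and Lie Groups*, GTM 94, Springer (1983),
  2.10(b), eqs. (2)–(4) (shuffle formula, full-permutation formula, and their ratio
  `(p+q)!/(p! q!)`).
* Mathlib: `Mathlib/LinearAlgebra/Alternating/DomCoprod.lean` (`AlternatingMap.domCoprod`,
  `MultilinearMap.domCoprod_alternization_eq`).
-/

noncomputable section

open Function
open scoped TensorProduct

namespace Literature.NumberTheory.Transcendental

section DomCoprod

variable {𝕜 : Type*} [RCLike 𝕜] {V : Type*} [NormedAddCommGroup V] [NormedSpace 𝕜 V]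
  {A : Type*} [NormedCommRing A] [NormedAlgebra 𝕜 A] {k l : ℕ}

/-- **Shuffle sum = `(k! l!)⁻¹ ×` full-permutation sum** (Warner (1983), 2.10(b), eq. (4):
`f ∧_α g = (p+q)!/(p! q!) f ∧_β g`, with (2), (3)), for Mathlib's shuffle product: for alternating
maps `a`, `b` of degrees `k`, `l` with values in a commutative `𝕜`-algebra `A` (`𝕜 = ℝ, ℂ`) and
`w : Fin k ⊕ Fin l → V`,
`mul' ((a.domCoprod b) w) = (k! l!)⁻¹ ∑_{σ ∈ Perm (Fin k ⊕ Fin l)} sign σ · a(w ∘ σ ∘ inl) b(w ∘ σ ∘ inr)`.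
From `MultilinearMap.domCoprod_alternization_eq` evaluated at `w`. [cite: WarnerGTM94, 2.10(b) (2)–(4)] -/
theorem mul'_domCoprod_apply (a : V [⋀^Fin k]→ₗ[𝕜] A) (b : V [⋀^Fin l]→ₗ[𝕜] A)
    (w : Fin k ⊕ Fin l → V) :
    LinearMap.mul' 𝕜 A (a.domCoprod b w) =
      ((k.factorial * l.factorial : ℕ) : 𝕜)⁻¹ •
        ∑ σ : Equiv.Perm (Fin k ⊕ Fin l), Equiv.Perm.sign σ •
          (a (fun i ↦ w (σ (Sum.inl i))) * b (fun j ↦ w (σ (Sum.inr j)))) := by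
  classical
  have hc : ((k.factorial * l.factorial : ℕ) : 𝕜) ≠ 0 :=
    Nat.cast_ne_zero.2 (Nat.mul_ne_zero (Nat.factorial_ne_zero k) (Nat.factorial_ne_zero l))
  have key := MultilinearMap.domCoprod_alternization_eq a b
  rw [Fintype.card_fin, Fintype.card_fin, ← Nat.cast_smul_eq_nsmul 𝕜] at key
  have hD : a.domCoprod b w = ((k.factorial * l.factorial : ℕ) : 𝕜)⁻¹ •
      MultilinearMap.alternatization (MultilinearMap.domCoprod a b :
        MultilinearMap 𝕜 (fun _ : Fin k ⊕ Fin l ↦ V) (A ⊗[𝕜] A)) w := by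
    rw [key, AlternatingMap.smul_apply, inv_smul_smul₀ hc]
  rw [hD, map_smul, MultilinearMap.alternatization_apply, map_sum]
  congr 1
  refine Finset.sum_congr rfl fun σ _ ↦ ?_
  simp only [MultilinearMap.domDomCongr_apply, MultilinearMap.domCoprod_apply,
    AlternatingMap.coe_multilinearMap, Units.smul_def, map_zsmul, LinearMap.mul'_apply]

end DomCoprod

end Literature.NumberTheory.Transcendental

namespace ContinuousAlternatingMap

section ToAlternatingMapWedge

variable {𝕜 : Type*} [RCLike 𝕜] {V : Type*} [NormedAddCommGroup V] [NormedSpace 𝕜 V]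
  {A : Type*} [NormedCommRing A] [NormedAlgebra 𝕜 A]

open Literature.NumberTheory.Transcendental

variable (𝕜 V A) in
/-- **The wedge product is Mathlib's shuffle product** (the named fact
`ContinuousAlternatingMap.ToAlternatingMapWedge`, discharged): for all degrees `k l` and all
continuous alternating maps `α`, `β` with values in a normed commutative algebra `A`, the
alternating map underlying `α ∧ β` is `mul' ∘ (α.domCoprod β)` reindexed along
`Fin k ⊕ Fin l ≃ Fin (k + l)`. Warner (1983), 2.10(b), eqs. (2)–(4): the shuffle formula (2) for
`∧_α` equals `(p! q!)⁻¹` times the sum (3)·`(p+q)!` over all of `S_{p+q}` (4) — the normalisation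
of `ContinuousAlternatingMap.wedge` (`wedge_apply`). Proof: `mul'_domCoprod_apply` and the
reindexing `finSumFinEquiv.permCongr` of permutations. Deliberate extension of the Mathlib
namespace `ContinuousAlternatingMap`. [cite: WarnerGTM94, 2.10(b) (2)–(4)] -/
theorem ToAlternatingMapWedge_holds : ToAlternatingMapWedge 𝕜 V A := by
  intro k l α β
  ext v
  rw [coe_toAlternatingMap, wedge_apply, AlternatingMap.domDomCongr_apply,
    LinearMap.compAlternatingMap_apply, mul'_domCoprod_apply]
  congr 1
  refine (Fintype.sum_equiv (Equiv.permCongr finSumFinEquiv) _ _ fun σ ↦ ?_).symm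
  simp only [Equiv.Perm.sign_permCongr, Equiv.permCongr_apply, finSumFinEquiv_symm_apply_castAdd,
    finSumFinEquiv_symm_apply_natAdd, comp_apply, coe_toAlternatingMap]

end ToAlternatingMapWedge

end ContinuousAlternatingMap
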